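import Literature.Computability.Complexity.IKWGeneratorsProofs
import Literature.Computability.Complexity.UniversalWitnessCircuitsGenerator
import HarnessLib

/-!
# Discharges of named facts of `UniversalWitnessCircuits.lean`

`Literature/Computability/Complexity/UniversalWitnessCircuitsHolds.lean` — proofs-only sibling
of `UniversalWitnessCircuits.lean` (no definitions, no named facts). Each theorem below closes
a named fact `X : Prop` of that file as `X_holds : X` by composing an ACCEPTED reduction
theorem of the tree with the ACCEPTED unconditional `_holds` discharges of all of its
hypotheses; nothing is re-proved and no statement is changed. Recorded by the librarian sweep
g25 (2026-08-16, pass 5c: facts dischargeable in one line from the tree's own lemmas), so that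
the facts census, `#h21_route_deps` and the cone guardrail see these facts as theorems.

Discharged here:

* `Williams2010_MA_io_of_not_witnessCircuits_holds` :=
  `Williams2010_MA_io_of_not_witnessCircuits_of_thm12_2` `IKW2002_thm12_2_holds`
  (`UniversalWitnessCircuitsGenerator.lean`).

## References

* [ImpagliazzoKabanetsWigderson2002] — see `lean/references.bib` and the docstring of the fact in `UniversalWitnessCircuits.lean`.
* [Williams2010STOC] — see `lean/references.bib` and the docstring of the fact in `UniversalWitnessCircuits.lean`.
-/

namespace Literature.Computability.Complexity

/-- **Discharge of the named fact `Williams2010_MA_io_of_not_witnessCircuits`**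
(`UniversalWitnessCircuits.lean`): Williams 2010, Appendix A (proof of Lemma 3.1 = Williams
2014, Thm. 5.2), first half: an infinitely-often nondeterministic simulation of `MA` with
sublinear advice from a verifier without witness circuits. Printed: … — obtained as
`Williams2010_MA_io_of_not_witnessCircuits_of_thm12_2` applied to the tree's unconditional
discharge `IKW2002_thm12_2_holds` of its hypothesis (reduction in
`UniversalWitnessCircuitsGenerator.lean`).
[cite: Williams2010STOC, Appendix A (proof of Lemma 3.1)]
[cite: ImpagliazzoKabanetsWigderson2002, Thm. 12 (2) and Lemma 17] -/
theorem Williams2010_MA_io_of_not_witnessCircuits_holds :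
    Williams2010_MA_io_of_not_witnessCircuits :=
  Williams2010_MA_io_of_not_witnessCircuits_of_thm12_2 IKW2002_thm12_2_holds

end Literature.Computability.Complexity
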